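import Summits.Ventures.Crystal3D.Theorems.StickyWulffConstantCoaxialWallLawIncoherentCount
import Summits.Ventures.Crystal3D.Theorems.StickyWulffConstantNoReconstructionGainOffLatticeMoved
import HarnessLib

/-!
# Incoherent translation pairs V: ARBITRARY fillings pay the whole free surface up to the FILLER'S OWN BONDS — a
# gas of third-material balls never lowers an incoherent wall; only a bonded third phase can

HONEST FRAMING. Venture `Summits/Ventures/Crystal3D` (cell `crystal3d-full`), helper `--supports` the crux
`CoaxialWallLaw` (stmt-Ventures-19481, `route-Ventures-StickyWulffConstant`), REGISTERED line `WallLedgerF` (planner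
cf-p1), open stub `stub_coaxialTwoSlabAdhesion`.  Rung credit only; F-C1 not moved.  Memo
HOME/wall-19481-p2/F-TWOPLATE-g5.md §6.  Sharpening of `…IncoherentThin` (`12` per filler ball) by lane-NRG's M2
(`fcc_offLattice_unitContacts_le_three_moved`: a point OFF a moved fcc lattice touches at most three of its points):
for an INCOHERENT pair (`τ + Λ₀` has no unit vector; the grains never touch) and ANY filling `X = X' ⊔ F` (`X'` on the
two lattices, `F` off both), a filler ball touches `≤ 3` balls of each grain, so restoring `F` to the rigid count of
`X'` (`translate_deficit_ge_incoherent_rigid`) costs `≤ 6` per filler adjacent to the window while the filler itself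
brings `12 − deg f ≥ 6 − deg_F f`; fillers outside the payer window but adjacent to it sit inside a complete sample's
slab, hence in the lateral rim band (covering radius `< 1` + separation), `O(ρ)` of them.  Net:

* `translate_deficit_ge_incoherent_gas` — `Σ_window (12 − deg) ≥ 2φ₁·πρ² − 12(12√2π + 36R₀ + 288)ρ − Σ_{f ∈ F} deg_F(f)`
  where `deg_F(f) = #{g ∈ F : dist f g = 1}` (so the loss is twice the number of filler–filler bonds);
* **`translate_twoSlabAdhesion_incoherent_of_gas`** — for every `C_G`: fillings whose filler part has
  `Σ_f deg_F(f) ≤ C_G (1+h) ρ` (e.g. pairwise non-touching fillers, any number) obey the stub's inequality with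
  adhesion term `φ₁ + φ₂ − φ₁`;
* **`coaxialTwoSlabAdhesion_classA_of_gas`** — class (A), `Λ₁ ≠ Λ₂`, same hypothesis: the stub's inequality VERBATIM
  at `(1/2)·√(1 − ⟪L e₃, e₃⟫²)` for every frame `L`.  Inputs: NONE beyond Musin's twelve (no census).

READING: an incoherent wall cheaper than the bottom free surface needs `≳ (φ₁ − c)·πρ²/2` filler–filler bonds in the
window — a BONDED third phase (then its two interfaces are ordinary grain boundaries: lane G / localisation).
WHAT THIS IS NOT: the stub; F-C1 not moved.
-/

noncomputable section

namespace Summit.Ventures.Crystal3D.Theorems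

open Summit.Ventures.Crystal3D Finset NearIdentity
open Literature.MathematicalPhysics.StatisticalMechanics (fccStacking barlowStacking constHagg IsHaggSeq
  contactDeficiency)
open scoped InnerProductSpace

open scoped Classical in
/-- **Complete samples have no foreign interior balls.**  A ball of `X` off the moved lattice `A·Λ₀ + t`, of lateral
radius `≤ ρ − 2`, cannot lie at a height whose unit neighbourhood is inside a height band where every lattice point
of radius `≤ ρ` belongs to `X` (covering radius `< 1` + `1`-separation). -/
theorem not_mem_interior_of_complete
    (A : EuclideanSpace ℝ (Fin 3) ≃ₗᵢ[ℝ] EuclideanSpace ℝ (Fin 3)) (t : EuclideanSpace ℝ (Fin 3))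
    (X : Finset (EuclideanSpace ℝ (Fin 3))) (hX : ∀ p ∈ X, ∀ q ∈ X, p ≠ q → 1 ≤ dist p q)
    {lo hi ρ : ℝ}
    (hcomp : ∀ y ∈ (fun q => A q + t) '' fccStacking 1 (Real.sqrt (2 / 3)),
      lo ≤ y 2 → y 2 ≤ hi → y 0 ^ 2 + y 1 ^ 2 ≤ ρ ^ 2 → y ∈ X)
    (hρ : 2 ≤ ρ) {x : EuclideanSpace ℝ (Fin 3)} (hx : x ∈ X)
    (hxΛ : x ∉ (fun q => A q + t) '' fccStacking 1 (Real.sqrt (2 / 3)))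
    (h1 : lo + 1 ≤ x 2) (h2 : x 2 ≤ hi - 1) (hrad : x 0 ^ 2 + x 1 ^ 2 ≤ (ρ - 2) ^ 2) : False := by
  set e₃ : EuclideanSpace ℝ (Fin 3) := EuclideanSpace.single (2 : Fin 3) (1 : ℝ) with he₃
  obtain ⟨y₀, hy₀, hd⟩ := exists_mem_barlowStacking_dist_lt_one constHagg (A.symm (x - t))
  set y : EuclideanSpace ℝ (Fin 3) := A y₀ + t with hy
  have hyΛ : y ∈ (fun q => A q + t) '' fccStacking 1 (Real.sqrt (2 / 3)) := ⟨y₀, hy₀, rfl⟩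
  have hdxy : dist x y < 1 := by
    have e : x - y = A (A.symm (x - t) - y₀) := by
      rw [map_sub, A.apply_symm_apply, hy]; abel
    rw [dist_eq_norm, e, LinearIsometryEquiv.norm_map, ← dist_eq_norm]; exact hd
  have hy2 : |y 2 - x 2| < 1 := by
    have h1' : |(y - x) 2| ≤ ‖y - x‖ := by
      rw [apply_two_eq_inner_e₃]
      calc |⟪y - x, e₃⟫_ℝ| ≤ ‖y - x‖ * ‖e₃‖ := abs_real_inner_le_norm _ _
        _ = ‖y - x‖ := by rw [he₃, PiLp.norm_single, norm_one, mul_one]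
    rw [← dist_eq_norm, dist_comm] at h1'
    have : (y - x) 2 = y 2 - x 2 := by rw [PiLp.sub_apply]
    rw [this] at h1'
    linarith
  obtain ⟨hy2a, hy2b⟩ := abs_lt.1 hy2
  have hyrad : Real.sqrt (y 0 ^ 2 + y 1 ^ 2) ≤ ρ - 1 := by
    have h1' := lateral_radius_le_add_dist y x
    have h2' : Real.sqrt (x 0 ^ 2 + x 1 ^ 2) ≤ ρ - 2 := by
      rw [← Real.sqrt_sq (by linarith : (0 : ℝ) ≤ ρ - 2)]
      exact Real.sqrt_le_sqrt hrad
    rw [dist_comm] at hdxy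
    linarith
  have hyrad' : y 0 ^ 2 + y 1 ^ 2 ≤ ρ ^ 2 := by
    have e4 := Real.sq_sqrt (by positivity : (0 : ℝ) ≤ y 0 ^ 2 + y 1 ^ 2)
    have e5 : (0 : ℝ) ≤ Real.sqrt (y 0 ^ 2 + y 1 ^ 2) := Real.sqrt_nonneg _
    nlinarith
  have hyX : y ∈ X := hcomp y hyΛ (by linarith) (by linarith) hyrad'
  have hne : x ≠ y := fun h => hxΛ (h ▸ hyΛ)
  have := hX x hx y hyX hne
  linarith

open scoped Classical in
/-- **The deficit count for an incoherent translation pair, arbitrary filling, up to the filler's own bonds.**  See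
the module docstring. -/
theorem translate_deficit_ge_incoherent_gas
    (A : EuclideanSpace ℝ (Fin 3) ≃ₗᵢ[ℝ] EuclideanSpace ℝ (Fin 3)) (t₁ t₂ : EuclideanSpace ℝ (Fin 3))
    (hA : ∀ q ∈ fccStacking 1 (Real.sqrt (2 / 3)), ‖q + A.symm (t₂ - t₁)‖ ≠ 1)
    (X P₁ P₂ : Finset (EuclideanSpace ℝ (Fin 3))) (R₀ h ρ : ℝ)
    (hR₀ : 10 ≤ R₀) (hh : 0 ≤ h) (hρ : R₀ ≤ ρ)
    (hX : ∀ p ∈ X, ∀ q ∈ X, p ≠ q → 1 ≤ dist p q)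
    (hcell : ∀ p ∈ X, -(2 * R₀) ≤ p 2 ∧ p 2 ≤ h + 2 * R₀ ∧ p 0 ^ 2 + p 1 ^ 2 ≤ ρ ^ 2)
    (hP₁X : P₁ ⊆ X) (hP₂X : P₂ ⊆ X)
    (hP₁ : ∀ p, p ∈ P₁ ↔ (p ∈ (fun q => A q + t₁) '' fccStacking 1 (Real.sqrt (2 / 3)) ∧
      -(2 * R₀) ≤ p 2 ∧ p 2 ≤ -R₀ ∧ p 0 ^ 2 + p 1 ^ 2 ≤ ρ ^ 2))
    (hP₂ : ∀ p, p ∈ P₂ ↔ (p ∈ (fun q => A q + t₂) '' fccStacking 1 (Real.sqrt (2 / 3)) ∧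
      h + R₀ ≤ p 2 ∧ p 2 ≤ h + 2 * R₀ ∧ p 0 ^ 2 + p 1 ^ 2 ≤ ρ ^ 2))
    (F : Finset (EuclideanSpace ℝ (Fin 3))) (hFX : F ⊆ X)
    (hF : ∀ x ∈ X, x ∈ (fun q => A q + t₁) '' fccStacking 1 (Real.sqrt (2 / 3)) ∨
      x ∈ (fun q => A q + t₂) '' fccStacking 1 (Real.sqrt (2 / 3)) ∨ x ∈ F)
    (hFoff : ∀ f ∈ F, f ∉ (fun q => A q + t₁) '' fccStacking 1 (Real.sqrt (2 / 3)) ∧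
      f ∉ (fun q => A q + t₂) '' fccStacking 1 (Real.sqrt (2 / 3))) :
    2 * (Real.sqrt 2 / 4 * ∑ᶠ w ∈ {w ∈ fccStacking 1 (Real.sqrt (2 / 3)) | ‖w‖ = 1},
        |⟪w, A.symm (EuclideanSpace.single (2 : Fin 3) (1 : ℝ))⟫_ℝ|) * Real.pi * ρ ^ 2 -
        12 * (12 * Real.sqrt 2 * Real.pi + 36 * R₀ + 288) * ρ -
        ∑ f ∈ F, ((F.filter fun g => dist f g = 1).card : ℝ) ≤
      ∑ z ∈ X.filter (fun z => -R₀ - 2 ≤ z 2 ∧ z 2 ≤ h + R₀ + 2),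
        ((12 : ℝ) - ((X.filter fun q => dist z q = 1).card : ℝ)) := by
  set Λ₁ := (fun q => A q + t₁) '' fccStacking 1 (Real.sqrt (2 / 3)) with hΛ₁
  set Λ₂ := (fun q => A q + t₂) '' fccStacking 1 (Real.sqrt (2 / 3)) with hΛ₂
  set X' := X.filter (fun x => x ∈ Λ₁ ∨ x ∈ Λ₂) with hX'
  have hX'X : X' ⊆ X := filter_subset _ _
  have hρ2 : (2 : ℝ) ≤ ρ := by linarith
  -- the rigid count on the lattice part
  have hX'sep : ∀ p ∈ X', ∀ q ∈ X', p ≠ q → 1 ≤ dist p q := fun p hp q hq => hX p (hX'X hp) q (hX'X hq)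
  have hcell' : ∀ p ∈ X', -(2 * R₀) ≤ p 2 ∧ p 2 ≤ h + 2 * R₀ ∧ p 0 ^ 2 + p 1 ^ 2 ≤ ρ ^ 2 :=
    fun p hp => hcell p (hX'X hp)
  have hP₁X' : P₁ ⊆ X' := fun p hp => mem_filter.2 ⟨hP₁X hp, Or.inl ((hP₁ p).1 hp).1⟩
  have hP₂X' : P₂ ⊆ X' := fun p hp => mem_filter.2 ⟨hP₂X hp, Or.inr ((hP₂ p).1 hp).1⟩
  have hrig : ∀ x ∈ X', x ∈ Λ₁ ∨ x ∈ Λ₂ := fun x hx => (mem_filter.1 hx).2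
  have hcount := translate_deficit_ge_incoherent_rigid A t₁ t₂ hA X' P₁ P₂ R₀ h ρ hR₀ hh hρ hX'sep hcell' hP₁X' hP₂X'
    hP₁ hP₂ hrig
  -- windows and rim bands
  set W := X.filter (fun z => -R₀ - 2 ≤ z 2 ∧ z 2 ≤ h + R₀ + 2) with hW
  set W' := X'.filter (fun z => -R₀ - 2 ≤ z 2 ∧ z 2 ≤ h + R₀ + 2) with hW'
  set WF := F.filter (fun z => -R₀ - 2 ≤ z 2 ∧ z 2 ≤ h + R₀ + 2) with hWF
  have hW'W : W' ⊆ W := fun z hz => mem_filter.2 ⟨hX'X (mem_filter.1 hz).1, (mem_filter.1 hz).2⟩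
  have hWFW : WF ⊆ W := fun z hz => mem_filter.2 ⟨hFX (mem_filter.1 hz).1, (mem_filter.1 hz).2⟩
  have hdisjW : Disjoint W' WF := by
    rw [Finset.disjoint_left]
    intro z hz hz'
    obtain ⟨h1, h2⟩ := hFoff z (mem_filter.1 hz').1
    rcases (mem_filter.1 (mem_filter.1 hz).1).2 with h' | h'
    · exact h1 h'
    · exact h2 h'
  set Bt := X.filter fun s => h + R₀ + 2 ≤ s 2 ∧ s 2 ≤ h + R₀ + 2 + 1 ∧ (ρ - 2) ^ 2 < s 0 ^ 2 + s 1 ^ 2 with hBt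
  set Bb := X.filter fun s => -R₀ - 3 ≤ s 2 ∧ s 2 ≤ -R₀ - 3 + 1 ∧ (ρ - 2) ^ 2 < s 0 ^ 2 + s 1 ^ 2 with hBb
  have hrim : ∀ (lo : ℝ) (B : Finset (EuclideanSpace ℝ (Fin 3))),
      B = X.filter (fun s => lo ≤ s 2 ∧ s 2 ≤ lo + 1 ∧ (ρ - 2) ^ 2 < s 0 ^ 2 + s 1 ^ 2) → (B.card : ℝ) ≤ 144 * ρ := by
    intro lo B hBdef
    have hsep : ∀ p ∈ B, ∀ q ∈ B, p ≠ q → 1 ≤ dist p q := fun p hp q hq hpq =>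
      hX p (by rw [hBdef] at hp; exact (mem_filter.1 hp).1) q (by rw [hBdef] at hq; exact (mem_filter.1 hq).1) hpq
    have hmem : ∀ p ∈ B, lo ≤ p 2 ∧ p 2 ≤ lo + 1 ∧ (ρ - 2) ^ 2 < p 0 ^ 2 + p 1 ^ 2 ∧ p 0 ^ 2 + p 1 ^ 2 ≤ ρ ^ 2 := by
      intro p hp
      rw [hBdef] at hp
      obtain ⟨hpX, h1, h2, h3⟩ := mem_filter.1 hp
      exact ⟨h1, h2, h3, (hcell p hpX).2.2⟩
    have key := card_mul_le_of_separated_in_shell B hsep lo (lo + 1) (ρ - 2) ρ (by linarith) (by linarith)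
      (by linarith) hmem
    have e : (lo + 1 - lo + 2) * (Real.pi * (ρ + 1) ^ 2 - Real.pi * (ρ - 2 - 1) ^ 2) =
        (Real.pi / 6) * (144 * ρ - 144) := by ring
    rw [e] at key
    have hπ : 0 < Real.pi / 6 := by positivity
    have := le_of_mul_le_mul_right (by linarith [key] : (B.card : ℝ) * (Real.pi / 6) ≤ (144 * ρ - 144) * (Real.pi / 6)) hπ
    linarith
  have hBt : (Bt.card : ℝ) ≤ 144 * ρ := hrim (h + R₀ + 2) Bt rfl
  have hBb : (Bb.card : ℝ) ≤ 144 * ρ := hrim (-R₀ - 3) Bb rfl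
  -- completeness of the two samples in the form `not_mem_interior_of_complete` wants
  have hcomp₂ : ∀ y ∈ Λ₂, h + R₀ ≤ y 2 → y 2 ≤ h + 2 * R₀ → y 0 ^ 2 + y 1 ^ 2 ≤ ρ ^ 2 → y ∈ X :=
    fun y hy h1 h2 h3 => hP₂X ((hP₂ y).2 ⟨hy, h1, h2, h3⟩)
  have hcomp₁ : ∀ y ∈ Λ₁, -(2 * R₀) ≤ y 2 → y 2 ≤ -R₀ → y 0 ^ 2 + y 1 ^ 2 ≤ ρ ^ 2 → y ∈ X :=
    fun y hy h1 h2 h3 => hP₁X ((hP₁ y).2 ⟨hy, h1, h2, h3⟩)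
  -- (1) degrees in `X` vs `X'` plus filler contacts
  have hdeg : ∀ z, ((X.filter fun q => dist z q = 1).card : ℝ) ≤
      ((X'.filter fun q => dist z q = 1).card : ℝ) + ((F.filter fun q => dist z q = 1).card : ℝ) := by
    intro z
    have hsub : (X.filter fun q => dist z q = 1) ⊆ (X'.filter fun q => dist z q = 1) ∪ (F.filter fun q => dist z q = 1) := by
      intro q hq
      obtain ⟨hqX, hd⟩ := mem_filter.1 hq
      rcases hF q hqX with h' | h' | h'
      · exact mem_union_left _ (mem_filter.2 ⟨mem_filter.2 ⟨hqX, Or.inl h'⟩, hd⟩)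
      · exact mem_union_left _ (mem_filter.2 ⟨mem_filter.2 ⟨hqX, Or.inr h'⟩, hd⟩)
      · exact mem_union_right _ (mem_filter.2 ⟨h', hd⟩)
    exact_mod_cast (card_le_card hsub).trans (card_union_le _ _)
  -- (2) M2: a filler ball touches at most `6` lattice balls, and only window-adjacent fillers matter
  have hM2 : ∀ f ∈ F, ((W'.filter fun z => dist z f = 1).card : ℝ) ≤ 6 := by
    intro f hf
    obtain ⟨hf₁, hf₂⟩ := hFoff f hf
    have hsplit : (W'.filter fun z => dist z f = 1) ⊆
        ((W'.filter fun z => dist z f = 1).filter fun z => z ∈ Λ₁) ∪ ((W'.filter fun z => dist z f = 1).filter fun z => z ∈ Λ₂) := by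
      intro z hz
      rcases (mem_filter.1 (mem_filter.1 (mem_filter.1 hz).1).1).2 with h' | h'
      · exact mem_union_left _ (mem_filter.2 ⟨hz, h'⟩)
      · exact mem_union_right _ (mem_filter.2 ⟨hz, h'⟩)
    have h₁ : (((W'.filter fun z => dist z f = 1).filter fun z => z ∈ Λ₁).card) ≤ 3 :=
      fcc_offLattice_unitContacts_le_three_moved A t₁ f hf₁ _ (fun y hy => by
        obtain ⟨hy, hyΛ⟩ := mem_filter.1 hy
        exact ⟨hyΛ, by rw [dist_comm]; exact (mem_filter.1 hy).2⟩)
    have h₂ : (((W'.filter fun z => dist z f = 1).filter fun z => z ∈ Λ₂).card) ≤ 3 :=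
      fcc_offLattice_unitContacts_le_three_moved A t₂ f hf₂ _ (fun y hy => by
        obtain ⟨hy, hyΛ⟩ := mem_filter.1 hy
        exact ⟨hyΛ, by rw [dist_comm]; exact (mem_filter.1 hy).2⟩)
    have := (card_le_card hsplit).trans ((card_union_le _ _).trans (add_le_add h₁ h₂))
    exact_mod_cast this
  -- fillers adjacent to the window but outside it are rim balls
  have hadj : ∀ f ∈ F, (W'.filter fun z => dist z f = 1) ≠ ∅ → f ∉ WF → f ∈ Bt ∪ Bb := by
    intro f hf hne hfW
    obtain ⟨z, hz⟩ := nonempty_iff_ne_empty.2 hne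
    obtain ⟨hzW', hdz⟩ := mem_filter.1 hz
    obtain ⟨-, hz1, hz2⟩ := mem_filter.1 hzW'
    obtain ⟨hf₁, hf₂⟩ := hFoff f hf
    have hfX := hFX hf
    -- `|f₂ − z₂| ≤ 1`
    have hfz : |(f - z) 2| ≤ 1 := by
      have h1' : |(f - z) 2| ≤ ‖f - z‖ := by
        rw [apply_two_eq_inner_e₃]
        calc |⟪f - z, EuclideanSpace.single (2 : Fin 3) (1 : ℝ)⟫_ℝ|
            ≤ ‖f - z‖ * ‖(EuclideanSpace.single (2 : Fin 3) (1 : ℝ) : EuclideanSpace ℝ (Fin 3))‖ :=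
              abs_real_inner_le_norm _ _
          _ = ‖f - z‖ := by rw [PiLp.norm_single, norm_one, mul_one]
      rw [← dist_eq_norm, dist_comm, hdz] at h1'; exact h1'
    rw [PiLp.sub_apply] at hfz
    obtain ⟨hfza, hfzb⟩ := abs_le.1 hfz
    have hnotW : ¬ (-R₀ - 2 ≤ f 2 ∧ f 2 ≤ h + R₀ + 2) := fun hw => hfW (mem_filter.2 ⟨hf, hw⟩)
    by_cases hrad : (ρ - 2) ^ 2 < f 0 ^ 2 + f 1 ^ 2
    · by_cases htop : h + R₀ + 2 ≤ f 2
      · exact mem_union_left _ (mem_filter.2 ⟨hfX, htop, by linarith, hrad⟩)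
      · push Not at htop
        have hbot : f 2 < -R₀ - 2 := by
          by_contra h'; push Not at h'; exact hnotW ⟨h', htop.le⟩
        exact mem_union_right _ (mem_filter.2 ⟨hfX, by linarith, by linarith, hrad⟩)
    · exfalso
      push Not at hrad
      by_cases htop : h + R₀ + 2 ≤ f 2
      · exact not_mem_interior_of_complete A t₂ X hX hcomp₂ hρ2 hfX hf₂ (by linarith) (by linarith) hrad
      · push Not at htop
        have hbot : f 2 < -R₀ - 2 := by
          by_contra h'; push Not at h'; exact hnotW ⟨h', htop.le⟩
        exact not_mem_interior_of_complete A t₁ X hX hcomp₁ hρ2 hfX hf₁ (by linarith [(hcell f hfX).1]) (by linarith) hrad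
  -- (3) the filler contacts of the window, double counted
  have hfill : ∑ z ∈ W', ((F.filter fun q => dist z q = 1).card : ℝ) ≤
      6 * (WF.card : ℝ) + 6 * ((Bt ∪ Bb).card : ℝ) := by
    have e1 : ∀ z ∈ W', ((F.filter fun q => dist z q = 1).card : ℝ) = ∑ f ∈ F, if dist z f = 1 then (1 : ℝ) else 0 := by
      intro z _; rw [← sum_filter]; simp
    rw [sum_congr rfl e1, sum_comm]
    have e2 : ∀ f ∈ F, (∑ z ∈ W', if dist z f = 1 then (1 : ℝ) else 0) = ((W'.filter fun z => dist z f = 1).card : ℝ) := by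
      intro f _; rw [← sum_filter]; simp
    rw [sum_congr rfl e2]
    -- split the fillers: in the window / adjacent rim / not adjacent
    have hle : ∀ f ∈ F, ((W'.filter fun z => dist z f = 1).card : ℝ) ≤
        (if f ∈ WF then 6 else 0) + (if f ∈ Bt ∪ Bb then 6 else 0) := by
      intro f hf
      by_cases hne : (W'.filter fun z => dist z f = 1) = ∅
      · rw [hne, card_empty, Nat.cast_zero]
        have h1 : (0 : ℝ) ≤ if f ∈ WF then 6 else 0 := by split_ifs <;> norm_num
        have h2 : (0 : ℝ) ≤ if f ∈ Bt ∪ Bb then 6 else 0 := by split_ifs <;> norm_num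
        linarith
      · have h6 := hM2 f hf
        by_cases hfW : f ∈ WF
        · rw [if_pos hfW]
          have h2 : (0 : ℝ) ≤ if f ∈ Bt ∪ Bb then 6 else 0 := by split_ifs <;> norm_num
          linarith
        · rw [if_neg hfW, if_pos (hadj f hf hne hfW)]; linarith
    refine (sum_le_sum hle).trans ?_
    rw [sum_add_distrib]
    have s1 : ∑ f ∈ F, (if f ∈ WF then (6 : ℝ) else 0) = 6 * (WF.card : ℝ) := by
      rw [← sum_filter]
      have : F.filter (fun f => f ∈ WF) = WF := by
        ext f; rw [mem_filter, hWF, mem_filter]; tauto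
      rw [this, sum_const, nsmul_eq_mul, mul_comm]
    have s2 : ∑ f ∈ F, (if f ∈ Bt ∪ Bb then (6 : ℝ) else 0) ≤ 6 * ((Bt ∪ Bb).card : ℝ) := by
      rw [← sum_filter, sum_const, nsmul_eq_mul, mul_comm]
      have : (F.filter fun f => f ∈ Bt ∪ Bb).card ≤ (Bt ∪ Bb).card :=
        card_le_card fun f hf => (mem_filter.1 hf).2
      have : ((F.filter fun f => f ∈ Bt ∪ Bb).card : ℝ) ≤ ((Bt ∪ Bb).card : ℝ) := by exact_mod_cast this
      linarith
    linarith
  have hBtb : ((Bt ∪ Bb).card : ℝ) ≤ 288 * ρ := by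
    have := card_union_le Bt Bb
    have : ((Bt ∪ Bb).card : ℝ) ≤ (Bt.card : ℝ) + (Bb.card : ℝ) := by exact_mod_cast this
    linarith
  -- (4) the fillers' own deficiency inside the window: `12 − deg f ≥ 6 − deg_F f`
  have hown : ∀ f ∈ WF, (6 : ℝ) - ((F.filter fun g => dist f g = 1).card : ℝ) ≤
      (12 : ℝ) - ((X.filter fun q => dist f q = 1).card : ℝ) := by
    intro f hfW
    have hf : f ∈ F := (mem_filter.1 hfW).1
    obtain ⟨hf₁, hf₂⟩ := hFoff f hf
    have hd := hdeg f
    have hlat : ((X'.filter fun q => dist f q = 1).card : ℝ) ≤ 6 := by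
      have hsplit : (X'.filter fun q => dist f q = 1) ⊆
          ((X'.filter fun q => dist f q = 1).filter fun z => z ∈ Λ₁) ∪ ((X'.filter fun q => dist f q = 1).filter fun z => z ∈ Λ₂) := by
        intro z hz
        rcases (mem_filter.1 (mem_filter.1 hz).1).2 with h' | h'
        · exact mem_union_left _ (mem_filter.2 ⟨hz, h'⟩)
        · exact mem_union_right _ (mem_filter.2 ⟨hz, h'⟩)
      have h₁ : (((X'.filter fun q => dist f q = 1).filter fun z => z ∈ Λ₁).card) ≤ 3 :=
        fcc_offLattice_unitContacts_le_three_moved A t₁ f hf₁ _ (fun y hy => by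
          obtain ⟨hy, hyΛ⟩ := mem_filter.1 hy
          exact ⟨hyΛ, (mem_filter.1 hy).2⟩)
      have h₂ : (((X'.filter fun q => dist f q = 1).filter fun z => z ∈ Λ₂).card) ≤ 3 :=
        fcc_offLattice_unitContacts_le_three_moved A t₂ f hf₂ _ (fun y hy => by
          obtain ⟨hy, hyΛ⟩ := mem_filter.1 hy
          exact ⟨hyΛ, (mem_filter.1 hy).2⟩)
      have := (card_le_card hsplit).trans ((card_union_le _ _).trans (add_le_add h₁ h₂))
      exact_mod_cast this
    linarith
  -- (5) assemble
  have hsumW' : ∑ z ∈ W', ((12 : ℝ) - ((X'.filter fun q => dist z q = 1).card : ℝ)) ≤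
      ∑ z ∈ W', ((12 : ℝ) - ((X.filter fun q => dist z q = 1).card : ℝ)) +
        ∑ z ∈ W', ((F.filter fun q => dist z q = 1).card : ℝ) := by
    rw [← sum_add_distrib]
    exact sum_le_sum fun z _ => by linarith [hdeg z]
  have hsplitW : ∑ z ∈ W', ((12 : ℝ) - ((X.filter fun q => dist z q = 1).card : ℝ)) +
      ∑ f ∈ WF, ((12 : ℝ) - ((X.filter fun q => dist f q = 1).card : ℝ)) ≤
      ∑ z ∈ W, ((12 : ℝ) - ((X.filter fun q => dist z q = 1).card : ℝ)) := by
    rw [← sum_union hdisjW]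
    refine sum_le_sum_of_subset_of_nonneg (union_subset hW'W hWFW) fun z _ _ => ?_
    have := card_filter_dist_eq_one_le_twelve X hX z
    have : ((X.filter fun q => dist z q = 1).card : ℝ) ≤ 12 := by exact_mod_cast this
    linarith
  have hownS := sum_le_sum hown
  rw [sum_sub_distrib, sum_const, nsmul_eq_mul] at hownS
  -- the filler bonds inside the window are part of all filler bonds
  have hFF : ∑ f ∈ WF, ((F.filter fun g => dist f g = 1).card : ℝ) ≤ ∑ f ∈ F, ((F.filter fun g => dist f g = 1).card : ℝ) :=
    sum_le_sum_of_subset_of_nonneg (filter_subset _ _) fun f _ _ => Nat.cast_nonneg _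
  have e288 : 12 * (12 * Real.sqrt 2 * Real.pi + 36 * R₀ + 288) * ρ =
      12 * (12 * Real.sqrt 2 * Real.pi + 36 * R₀ + 144) * ρ + 6 * (288 * ρ) := by ring
  rw [e288]
  linarith [hcount, hfill, hBtb, hsumW', hsplitW, hownS, hFF]

end Summit.Ventures.Crystal3D.Theorems

end
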